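import Summits.QuantumFields.YangMills.Theorems.SwapVirialDeficitSectorLaplaceEndGaussN2Near
import Summits.QuantumFields.YangMills.Theorems.SwapVirialDeficitSectorLaplaceEndGaussSlabMatchGroup
import Summits.QuantumFields.YangMills.Theorems.SwapVirialDeficitSigmaBallGroupFarFloor
import Summits.QuantumFields.YangMills.Theorems.SwapVirialDeficitSectorLaplaceBTubeFibredScaled
import HarnessLib

/-!
# N2 OF `stub_end_gaussCore`: THE GLUE — near (matched ∕ crude) and far cases in ONE pointwise fibre bound of w3's `hN2` shape
# (free-hands support of ⟨stmt-QuantumFields-24197⟩ `SwapVirialDeficit.SwapGluedStiffness`; LEAD g99 memo11d)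

Per hub letter `δ = t 0` and leaders `(u, t, v, z)` of the end Gaussian core, for any integrand `g ≤ e^{−bF̂}` supported on the core (hypotheses `hgle`, `hgcore`):
`∫⁻ F, bDensity·g ≤ (A·D(t 1, t 2) + T)·X·Y·Z` with the reference follower determinant `D` at `hubAt 0 1` ((I1)∕(I2)), `A = ofReal(e^{1/2}·Gauss_b)` and an explicit
threshold tail `T`.  Cases: FAR (T1's sockets at OUR thresholds `sT, κf` fail) by w3's ✓`endGauss_N2_far`; NEAR by w3's ✓`endGauss_N2_near_raw` (T1 at full `b`), then
GROUP-near (✓`sqrt_det_inv_slabHub_le_ref_group`, exponent `≤ ½` by the smallness hypotheses (S1)) or GROUP-far (✓`det_ge_pow_of_coercive` + LEAD ✓`exp_three_floor_le_of_groupFar`).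

HONEST LABEL: composition; the memo-ε plug of `stub_end_gaussCore`, `stub_core_tip`, ⟨24197⟩ ∕ ⟨24194⟩ remain OPEN; own crux ⟨22884⟩ OPEN (blocked-on ⟨19935⟩); the Yang–Mills
mass gap is NOT proved; no summit is proved by a line.  THEOREMS ONLY (0 `def`, 0 `sorry`, no instance), standard axioms.  LEAD seat ym-line-sfw-p2 g99, `--supports stmt-QuantumFields-24197`.
References: [cite: Luscher1983, §2]; [folklore].
-/

set_option autoImplicit false
set_option synthInstance.maxSize 1024

noncomputable section

open MeasureTheory Quaternion Set Module
open scoped Quaternion BigOperators ENNReal InnerProductSpace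
open Literature.MathematicalPhysics.QuantumLattice
open Literature.MathematicalPhysics.QuantumFieldTheory hiding SU2

namespace Summit.QuantumFields.YangMills.Theorems.SwapVirialDeficit.SectorLaplace

open Summit.QuantumFields.YangMills.Theorems.FemtoTransferGap
open Summit.QuantumFields.YangMills.Theorems.FemtoTransferGap.TT
open Summit.QuantumFields.YangMills.Theorems.VirialFluxGap.RingDeficit
open Summit.QuantumFields.YangMills.Theorems.SwapVirialDeficit.SwapRing
open Summit.QuantumFields.YangMills.Theorems.SwapVirialDeficit.BlowUpRing
open Summit.QuantumFields.YangMills.Theorems.SwapVirialDeficit.SigmaBall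
open Summit.QuantumFields.YangMills.Theorems.SwapVirialDeficit.Gnomonic (gnomonicWeight piWeight normSq3 gnomonicWeight_pos normSq3_nonneg)

variable {L : ℕ} [NeZero L]

/-- `gnomonicWeight ![a, b, c] = ((1 + a² + (b² + c²))²)⁻¹`. [folklore] -/
theorem gnomonicWeight_vec3 (a b c : ℝ) : gnomonicWeight (![a, b, c] : Fin 3 → ℝ) = ((1 + a ^ 2 + (b ^ 2 + c ^ 2)) ^ 2)⁻¹ := by
  show ((1 + normSq3 (![a, b, c] : Fin 3 → ℝ))⁻¹) ^ 2 = _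
  rw [normSq3_vec3, inv_pow]; ring

/-- In `ℝ≥0∞`: if `x ≤ E * (G + T₁) * W` with `E ≤ 1`, `G ≤ G'` then `x ≤ (G' + T₁) * W`. [folklore] -/
theorem ennreal_glue_le {x E G G' T₁ W : ℝ≥0∞} (h : x ≤ E * (G + T₁) * W) (hE : E ≤ 1) (hG : G ≤ G') : x ≤ (G' + T₁) * W := by
  refine h.trans ?_
  calc E * (G + T₁) * W ≤ 1 * (G' + T₁) * W := mul_le_mul' (mul_le_mul' hE (add_le_add hG le_rfl)) le_rfl
    _ = (G' + T₁) * W := by rw [one_mul]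

set_option maxHeartbeats 1600000 in
/-- ★★★ **N2 — THE POINTWISE FIBRE BOUND OF THE END GAUSSIAN CORE, GLUED** (memo11d).  Reference family `AF` at `hubAt 0 1` (I1); `0 < τ ≤ ½`; split thresholds
`0 ≤ sT`, `0 ≤ κf` below T1's (`hs2`, `hκf`); group radius `0 < r ≤ 1` with `18τ² ≤ r²` and the matching smallness (S1): `3|Fol|·3219264L⁴r ≤ μ/4`,
`3219264L⁴r ≤ μ/4`, `(122689728·s + 44712000·√(κf/μ))·L⁴ ≤ μ/(24|Fol|)` and `≤ μ/4`; `g ≤ e^{−bF̂}` and `g` vanishes off the core (`hgcore`).  Then for `|t 0| < s`: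
`∫⁻ F, bDensity·g ≤ (A·D(t 1,t 2) + T)·X·Y·Z`. [cite: Luscher1983, §2] -/
theorem endGauss_N2_glue {ε : GnoSign L} (hε : GoodSign ε) {AF : GnoCoord L → GnoFol L →ₗ[ℝ] GnoFol L} (hFs : ∀ η, (AF η).IsSymmetric)
    (hFyy : ∀ η (y : GnoFol L), ⟪AF η y, y⟫_ℝ =
      iteratedFDeriv ℝ 2 (fun y' : GnoFol L => gnoDeficit (fun _ => false) (fun _ => 1) (hubAt 0 1) ε (η + gnoFolEmb y')) 0 (fun _ => y))
    (hamb : ∀ η (y : GnoFol L), ⟪AF η y, y⟫_ℝ = iteratedFDeriv ℝ 2 (gnoDeficit (fun _ => false) (fun _ => 1) (hubAt 0 1) ε) η (fun _ => gnoFolEmb y))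
    {τ s r sT κf b : ℝ} (hτ : 0 < τ) (hb : 0 < b) (hr0 : 0 < r) (hr1 : r ≤ 1) (hτr : 18 * τ ^ 2 ≤ r ^ 2)
    (hsT : 0 ≤ sT) (hs2 : sT ^ 2 ≤ ((2304 * (L : ℝ) ^ 6 * (Fintype.card (Fol L) : ℝ))⁻¹) ^ 2 / (304992000000 * (L : ℝ) ^ 8))
    (hκf0 : 0 ≤ κf)
    (hκf : κf ≤ (2304 * (L : ℝ) ^ 6 * (Fintype.card (Fol L) : ℝ))⁻¹ *
      ((2304 * (L : ℝ) ^ 6 * (Fintype.card (Fol L) : ℝ))⁻¹ / (6 * (2484000 * (L : ℝ) ^ 4))) ^ 2 / 4)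
    (hDsmall : 3219264 * (L : ℝ) ^ 4 * r ≤ (2304 * (L : ℝ) ^ 6 * (Fintype.card (Fol L) : ℝ))⁻¹ / 4)
    (hE2 : 3 * (Fintype.card (Fol L) : ℝ) * (3219264 * (L : ℝ) ^ 4 * r) / (2304 * (L : ℝ) ^ 6 * (Fintype.card (Fol L) : ℝ))⁻¹ ≤ 1 / 4)
    (hnear : (122689728 * s + 44712000 * Real.sqrt (κf / (2304 * (L : ℝ) ^ 6 * (Fintype.card (Fol L) : ℝ))⁻¹)) * (L : ℝ) ^ 4 ≤
      (2304 * (L : ℝ) ^ 6 * (Fintype.card (Fol L) : ℝ))⁻¹ / 4)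
    (hE1 : 3 * (Fintype.card (Fol L) : ℝ) * ((122689728 * s + 44712000 * Real.sqrt (κf / (2304 * (L : ℝ) ^ 6 * (Fintype.card (Fol L) : ℝ))⁻¹)) * (L : ℝ) ^ 4) /
      ((2304 * (L : ℝ) ^ 6 * (Fintype.card (Fol L) : ℝ))⁻¹ / 2) ≤ 1 / 4)
    (g : ℝ × GnoCoord L → ℝ≥0∞) (u : ℝ × ℝ) (t : Fin 3 → ℝ) (v : Fin 2 → ℝ) (z : Fin 3 → ℝ) (hδs : t 0 ∈ Ioo (-s) s)
    (hgle : ∀ F : Fol L → Fin 3 → ℝ, g (t 0, ((((![t 1, u.1, u.2] : Fin 3 → ℝ), (![t 2, v 0, v 1] : Fin 3 → ℝ)), (z, F)) : GnoCoord L)) ≤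
      ENNReal.ofReal (Real.exp (-(b * gnoDeficit (fun _ => false) (fun _ => 1) (hubAt (t 0) 1) ε ((((![t 1, u.1, u.2] : Fin 3 → ℝ), (![t 2, v 0, v 1] : Fin 3 → ℝ)), (z, F)) : GnoCoord L)))))
    (hgcore : (∃ F : Fol L → Fin 3 → ℝ, g (t 0, ((((![t 1, u.1, u.2] : Fin 3 → ℝ), (![t 2, v 0, v 1] : Fin 3 → ℝ)), (z, F)) : GnoCoord L)) ≠ 0) →
      (t 0) ^ 2 ≤ 1 / 3 ∧ u.1 ^ 2 + u.2 ^ 2 ≤ 1 + (t 1) ^ 2 ∧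
        (u.1 ^ 2 + u.2 ^ 2 < τ ^ 2 ∨ 12 * τ ^ 2 ≤ 16 * (t 0) ^ 2 / (1 + (t 0) ^ 2) + 8 * (t 1) ^ 2 / ((1 + (t 1) ^ 2) * (1 + (t 0) ^ 2)) + 4 * (t 2) ^ 2 / (1 + (t 2) ^ 2))) :
    ∫⁻ F : Fol L → Fin 3 → ℝ,
        ENNReal.ofReal (((1 + (t 0) ^ 2)⁻¹) ^ 2 * gnoDensity ((((![t 1, u.1, u.2] : Fin 3 → ℝ), (![t 2, v 0, v 1] : Fin 3 → ℝ)), (z, F)) : GnoCoord L)) *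
          g (t 0, ((((![t 1, u.1, u.2] : Fin 3 → ℝ), (![t 2, v 0, v 1] : Fin 3 → ℝ)), (z, F)) : GnoCoord L)) ≤
      (ENNReal.ofReal (Real.exp (1 / 2) * (2 * Real.pi / ((1 - 1 / (2 * (finrank ℝ (GnoFol L) : ℝ))) * b)) ^ ((finrank ℝ (GnoFol L) : ℝ) / 2)) *
            ENNReal.ofReal ((Real.sqrt (LinearMap.det (AF (gnoBase (t 1) (t 2)))))⁻¹) +
          (ENNReal.ofReal (Real.exp (-(5 * b / 6 * (min (sT ^ 2) (κf / (300 * (L : ℝ) ^ 4)) / (3600 * (L : ℝ) ^ 6))))) *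
              (∫⁻ F : Fol L → Fin 3 → ℝ, ENNReal.ofReal (piWeight F)) +
            ENNReal.ofReal (Real.exp (-(b * ((2304 * (L : ℝ) ^ 6 * (Fintype.card (Fol L) : ℝ))⁻¹ *
                (3 * ((2304 * (L : ℝ) ^ 6 * (Fintype.card (Fol L) : ℝ))⁻¹ / 2) / (2 * (finrank ℝ (GnoFol L) : ℝ) * (2484000 * (L : ℝ) ^ 4))) ^ 2 / 4))) *
              (∫ w : GnoFol L, piWeight (gnoFolBlocks w))) +
            ENNReal.ofReal (Real.exp (-(5 * b / 6 * (min (12 * τ ^ 2) 1 * (r ^ 2 / 18) / (55200 * (L : ℝ) ^ 6)))) *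
              ((2 * Real.pi / ((1 - 1 / (2 * (finrank ℝ (GnoFol L) : ℝ))) * b)) ^ ((finrank ℝ (GnoFol L) : ℝ) / 2) *
                (((2304 * (L : ℝ) ^ 6 * (Fintype.card (Fol L) : ℝ))⁻¹ / 2) ^ finrank ℝ (GnoFol L))⁻¹ ^ (1 / 2 : ℝ))))) *
        ENNReal.ofReal (((1 + t 1 ^ 2 + (u.1 ^ 2 + u.2 ^ 2)) ^ 2)⁻¹ * Real.exp (-(b / (6 * (55200 * (L : ℝ) ^ 6)) *
          (16 * (t 0) ^ 2 / (1 + (t 0) ^ 2) + 8 * (t 1) ^ 2 / ((1 + (t 1) ^ 2) * (1 + (t 0) ^ 2)) + 4 * (t 2) ^ 2 / (1 + (t 2) ^ 2)) *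
          (u.1 ^ 2 + u.2 ^ 2) / (1 + t 1 ^ 2 + (u.1 ^ 2 + u.2 ^ 2))))) *
        ENNReal.ofReal (((1 + t 2 ^ 2 + (v 0 ^ 2 + v 1 ^ 2)) ^ 2)⁻¹ * Real.exp (-(b / (6 * (55200 * (L : ℝ) ^ 6)) * (v 0 ^ 2 + v 1 ^ 2) / (1 + t 2 ^ 2 + (v 0 ^ 2 + v 1 ^ 2))))) *
        ENNReal.ofReal (gnomonicWeight z * Real.exp (-(b / (6 * (55200 * (L : ℝ) ^ 6)) * normSq3 z / (1 + normSq3 z)))) := by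
  -- abbreviations for the three Gaussian factors and the constants (ℝ≥0∞)
  set X : ℝ≥0∞ := ENNReal.ofReal (((1 + t 1 ^ 2 + (u.1 ^ 2 + u.2 ^ 2)) ^ 2)⁻¹ * Real.exp (-(b / (6 * (55200 * (L : ℝ) ^ 6)) *
          (16 * (t 0) ^ 2 / (1 + (t 0) ^ 2) + 8 * (t 1) ^ 2 / ((1 + (t 1) ^ 2) * (1 + (t 0) ^ 2)) + 4 * (t 2) ^ 2 / (1 + (t 2) ^ 2)) *
          (u.1 ^ 2 + u.2 ^ 2) / (1 + t 1 ^ 2 + (u.1 ^ 2 + u.2 ^ 2))))) with hXdef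
  set Y : ℝ≥0∞ := ENNReal.ofReal (((1 + t 2 ^ 2 + (v 0 ^ 2 + v 1 ^ 2)) ^ 2)⁻¹ * Real.exp (-(b / (6 * (55200 * (L : ℝ) ^ 6)) * (v 0 ^ 2 + v 1 ^ 2) / (1 + t 2 ^ 2 + (v 0 ^ 2 + v 1 ^ 2))))) with hYdef
  set Z : ℝ≥0∞ := ENNReal.ofReal (gnomonicWeight z * Real.exp (-(b / (6 * (55200 * (L : ℝ) ^ 6)) * normSq3 z / (1 + normSq3 z)))) with hZdef
  set μ : ℝ := (2304 * (L : ℝ) ^ 6 * (Fintype.card (Fol L) : ℝ))⁻¹ with hμ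
  set dF : ℕ := finrank ℝ (GnoFol L) with hdF
  set Gb : ℝ := (2 * Real.pi / ((1 - 1 / (2 * (dF : ℝ))) * b)) ^ ((dF : ℝ) / 2) with hGb
  set Dref : ℝ≥0∞ := ENNReal.ofReal ((Real.sqrt (LinearMap.det (AF (gnoBase (t 1) (t 2)))))⁻¹) with hDref
  set Aconst : ℝ≥0∞ := ENNReal.ofReal (Real.exp (1 / 2) * Gb) with hA
  set Tfar : ℝ≥0∞ := ENNReal.ofReal (Real.exp (-(5 * b / 6 * (min (sT ^ 2) (κf / (300 * (L : ℝ) ^ 4)) / (3600 * (L : ℝ) ^ 6))))) *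
    (∫⁻ F : Fol L → Fin 3 → ℝ, ENNReal.ofReal (piWeight F)) with hTfar
  set T1t : ℝ≥0∞ := ENNReal.ofReal (Real.exp (-(b * (μ * (3 * (μ / 2) / (2 * (dF : ℝ) * (2484000 * (L : ℝ) ^ 4))) ^ 2 / 4))) *
    (∫ w : GnoFol L, piWeight (gnoFolBlocks w))) with hT1t
  set T2 : ℝ≥0∞ := ENNReal.ofReal (Real.exp (-(5 * b / 6 * (min (12 * τ ^ 2) 1 * (r ^ 2 / 18) / (55200 * (L : ℝ) ^ 6)))) *
    (Gb * ((μ / 2) ^ dF)⁻¹ ^ (1 / 2 : ℝ))) with hT2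
  -- the point
  set x3 : Fin 3 → ℝ := ![t 1, u.1, u.2] with hx3
  set y3 : Fin 3 → ℝ := ![t 2, v 0, v 1] with hy3
  have hx0 : x3 0 = t 1 := rfl
  have hx1 : x3 1 = u.1 := rfl
  have hx2 : x3 2 = u.2 := rfl
  have hy0 : y3 0 = t 2 := rfl
  have hy1 : y3 1 = v 0 := rfl
  have hy2 : y3 2 = v 1 := rfl
  have hL : (0 : ℝ) < L := by exact_mod_cast NeZero.pos L
  have hμ0 : 0 < μ := by rw [hμ]; exact (folMu_pos_le (L := L)).1
  -- goal restated with the abbreviations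
  show ∫⁻ F : Fol L → Fin 3 → ℝ, ENNReal.ofReal (((1 + (t 0) ^ 2)⁻¹) ^ 2 * gnoDensity (((x3, y3), (z, F)) : GnoCoord L)) * g (t 0, (((x3, y3), (z, F)) : GnoCoord L)) ≤
      (Aconst * Dref + (Tfar + T1t + T2)) * X * Y * Z
  -- trivial case: `g` vanishes on the fibre
  by_cases hzero : ∀ F : Fol L → Fin 3 → ℝ, g (t 0, (((x3, y3), (z, F)) : GnoCoord L)) = 0
  · have : ∫⁻ F : Fol L → Fin 3 → ℝ, ENNReal.ofReal (((1 + (t 0) ^ 2)⁻¹) ^ 2 * gnoDensity (((x3, y3), (z, F)) : GnoCoord L)) * g (t 0, (((x3, y3), (z, F)) : GnoCoord L)) = 0 := by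
      rw [lintegral_congr fun F => by rw [hzero F, mul_zero], lintegral_zero]
    rw [this]; exact zero_le
  push Not at hzero
  obtain ⟨hδ, hu, hloc⟩ := hgcore hzero
  -- the NEAR ∕ FAR split at OUR thresholds
  by_cases hT1 : ((∀ μ' ν : Fin 3, frobNorm ((((blowUpPoint 1 (gnomonicPoint (hubAt (t 0) 1) ε (((x3, y3), (z, (0 : Fol L → Fin 3 → ℝ))) : GnoCoord L))).1 (Fin.castSucc μ') *
        (blowUpPoint 1 (gnomonicPoint (hubAt (t 0) 1) ε (((x3, y3), (z, (0 : Fol L → Fin 3 → ℝ))) : GnoCoord L))).1 (Fin.castSucc ν) : SU2) : Matrix (Fin 2) (Fin 2) ℂ) -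
        (((blowUpPoint 1 (gnomonicPoint (hubAt (t 0) 1) ε (((x3, y3), (z, (0 : Fol L → Fin 3 → ℝ))) : GnoCoord L))).1 (Fin.castSucc ν) *
        (blowUpPoint 1 (gnomonicPoint (hubAt (t 0) 1) ε (((x3, y3), (z, (0 : Fol L → Fin 3 → ℝ))) : GnoCoord L))).1 (Fin.castSucc μ') : SU2) : Matrix (Fin 2) (Fin 2) ℂ)) ≤ sT) ∧
      (∀ μ' : Fin 3, frobNorm ((((blowUpPoint 1 (gnomonicPoint (hubAt (t 0) 1) ε (((x3, y3), (z, (0 : Fol L → Fin 3 → ℝ))) : GnoCoord L))).1 (Fin.last 3) *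
        (blowUpPoint 1 (gnomonicPoint (hubAt (t 0) 1) ε (((x3, y3), (z, (0 : Fol L → Fin 3 → ℝ))) : GnoCoord L))).1 (Fin.castSucc (Equiv.swap (0 : Fin 3) 1 μ')) : SU2) :
          Matrix (Fin 2) (Fin 2) ℂ) -
        (((blowUpPoint 1 (gnomonicPoint (hubAt (t 0) 1) ε (((x3, y3), (z, (0 : Fol L → Fin 3 → ℝ))) : GnoCoord L))).1 (Fin.castSucc μ') *
        (blowUpPoint 1 (gnomonicPoint (hubAt (t 0) 1) ε (((x3, y3), (z, (0 : Fol L → Fin 3 → ℝ))) : GnoCoord L))).1 (Fin.last 3) : SU2) : Matrix (Fin 2) (Fin 2) ℂ)) ≤ sT) ∧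
      gnoDeficit (fun _ => false) (fun _ => 1) (hubAt (t 0) 1) ε (((x3, y3), (z, (0 : Fol L → Fin 3 → ℝ))) : GnoCoord L) ≤ κf)
  swap
  · -- FAR: w3's tail bound
    have hfar := endGauss_N2_far (L := L) ε hε.2 u t v z hδ hu hb.le hsT hκf0 g hgle hT1
    refine hfar.trans ?_
    show Tfar * X * Y * Z ≤ (Aconst * Dref + (Tfar + T1t + T2)) * X * Y * Z
    have hT : Tfar ≤ Aconst * Dref + (Tfar + T1t + T2) :=
      calc Tfar ≤ Tfar + T1t + T2 := by rw [add_assoc]; exact le_self_add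
        _ ≤ Aconst * Dref + (Tfar + T1t + T2) := le_add_self
    exact mul_le_mul' (mul_le_mul' (mul_le_mul' hT le_rfl) le_rfl) le_rfl
  · -- NEAR: T1 at full `b` with the slab family at `hubAt δ 1`
    obtain ⟨hCC, hσ, hflat⟩ := hT1
    obtain ⟨A, hAs, -, hAyy, hray, hambA, -, -⟩ := exists_gnoFolHessian (L := L) (fun _ => false) (fun _ => (1 : SU2)) (hubAt_one_ne_zero (t 0)) ε
    have hflat' : gnoDeficit (fun _ => false) (fun _ => 1) (hubAt (t 0) 1) ε (((x3, y3), (z, (0 : Fol L → Fin 3 → ℝ))) : GnoCoord L) ≤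
        (2304 * (L : ℝ) ^ 6 * (Fintype.card (Fol L) : ℝ))⁻¹ * ((2304 * (L : ℝ) ^ 6 * (Fintype.card (Fol L) : ℝ))⁻¹ / (6 * (2484000 * (L : ℝ) ^ 4))) ^ 2 / 4 :=
      hflat.trans hκf
    have hux : (x3 1) ^ 2 + (x3 2) ^ 2 ≤ 1 + (x3 0) ^ 2 := by rw [hx0, hx1, hx2]; exact hu
    have hgle' : ∀ F : Fol L → Fin 3 → ℝ, g (t 0, (((x3, y3), (z, F)) : GnoCoord L)) ≤
        ENNReal.ofReal (Real.exp (-(b * gnoDeficit (fun _ => false) (fun _ => 1) (hubAt (t 0) 1) ε (((x3, y3), (z, F)) : GnoCoord L)))) := fun F => hgle F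
    obtain ⟨ys, hys, hcoer, hint⟩ := endGauss_N2_near_raw (L := L) ε hε.2 (t 0) x3 y3 z hδ hux hb g hgle' hAs hAyy hray hsT hCC hσ hs2 hflat'
    -- identify the three Gaussian factors of `near_raw` with `X, Y, Z`
    have eX : ENNReal.ofReal (gnomonicWeight x3 * Real.exp (-(b / (6 * (55200 * (L : ℝ) ^ 6)) *
          (16 * (t 0) ^ 2 / (1 + (t 0) ^ 2) + 8 * (x3 0) ^ 2 / ((1 + (x3 0) ^ 2) * (1 + (t 0) ^ 2)) + 4 * (y3 0) ^ 2 / (1 + (y3 0) ^ 2)) *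
          ((x3 1) ^ 2 + (x3 2) ^ 2) / (1 + (x3 0) ^ 2 + ((x3 1) ^ 2 + (x3 2) ^ 2))))) = X := by
      rw [hXdef, hx0, hx1, hx2, hy0, hx3, gnomonicWeight_vec3]
    have eY : ENNReal.ofReal (gnomonicWeight y3 * Real.exp (-(b / (6 * (55200 * (L : ℝ) ^ 6)) * ((y3 1) ^ 2 + (y3 2) ^ 2) / (1 + (y3 0) ^ 2 + ((y3 1) ^ 2 + (y3 2) ^ 2))))) = Y := by
      rw [hYdef, hy0, hy1, hy2, hy3, gnomonicWeight_vec3]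
    rw [eX, eY] at hint
    rw [← hZdef, ← hdF] at hint
    -- the common factor `e^{−(5b/6)m⋆} ≤ 1`
    set m : ℝ := gnoDeficit (fun _ => false) (fun _ => 1) (hubAt (t 0) 1) ε ((((x3, y3), (z, (0 : Fol L → Fin 3 → ℝ))) : GnoCoord L) + gnoFolEmb ys) with hm
    have hm0 : 0 ≤ m := gnoDeficit_nonneg _ _ _ _ _
    have hEle1 : ENNReal.ofReal (Real.exp (-(5 * b / 6 * m))) ≤ 1 := by
      rw [← ENNReal.ofReal_one]; refine ENNReal.ofReal_le_ofReal ?_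
      rw [Real.exp_le_one_iff, neg_nonpos]; positivity
    -- determinant positivity at `η⋆` from the coercivity
    have hdet : (μ / 2) ^ dF ≤ LinearMap.det (A ((((x3, y3), (z, (0 : Fol L → Fin 3 → ℝ))) : GnoCoord L) + gnoFolEmb ys)) :=
      det_ge_pow_of_coercive (hAs _) (by positivity) hcoer
    have hdetpos : 0 < LinearMap.det (A ((((x3, y3), (z, (0 : Fol L → Fin 3 → ℝ))) : GnoCoord L) + gnoFolEmb ys)) := lt_of_lt_of_le (by positivity) hdet
    have hd9 := nine_le_finrank_gnoFol (L := L)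
    have hd1 : (1 : ℝ) ≤ (dF : ℝ) := by
      have h9 : ((9 : ℕ) : ℝ) ≤ ((finrank ℝ (GnoFol L) : ℕ) : ℝ) := by exact_mod_cast hd9
      rw [hdF]; push_cast at h9; linarith
    have h1d : 0 < 1 - 1 / (2 * (dF : ℝ)) := by
      rw [sub_pos, div_lt_one (by positivity)]; linarith
    have hGb0 : 0 ≤ Gb := by
      rw [hGb]
      exact Real.rpow_nonneg (div_nonneg (by positivity) (mul_nonneg h1d.le hb.le)) _
    by_cases hD : Real.sqrt (2 * ((x3 1) ^ 2 + (x3 2) ^ 2) / (1 + ((x3 0) ^ 2 + (x3 1) ^ 2 + (x3 2) ^ 2))) +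
        Real.sqrt (2 * ((z 0) ^ 2 + (z 1) ^ 2 + (z 2) ^ 2) / (1 + ((z 0) ^ 2 + (z 1) ^ 2 + (z 2) ^ 2))) +
        Real.sqrt (2 * ((y3 1) ^ 2 + (y3 2) ^ 2) / (1 + ((y3 0) ^ 2 + (y3 1) ^ 2 + (y3 2) ^ 2))) ≤ r
    · -- NEAR₁: matched determinant
      have hys_norm : ‖(gnoFolEmb ys : GnoCoord L)‖ ≤ Real.sqrt (κf / μ) := by
        refine (norm_gnoFolEmb_le ys).trans ?_
        rw [← Real.sqrt_sq (norm_nonneg ys)]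
        exact Real.sqrt_le_sqrt (hys.trans (div_le_div_of_nonneg_right hflat hμ0.le))
      have hδabs : |t 0| ≤ s := (abs_lt.2 ⟨hδs.1, hδs.2⟩).le
      have hΔle : (122689728 * |t 0| + 44712000 * ‖(gnoFolEmb ys : GnoCoord L)‖) * (L : ℝ) ^ 4 ≤
          (122689728 * s + 44712000 * Real.sqrt (κf / μ)) * (L : ℝ) ^ 4 := by
        refine mul_le_mul_of_nonneg_right ?_ (by positivity)
        linarith [mul_le_mul_of_nonneg_left hδabs (by norm_num : (0 : ℝ) ≤ 122689728),
          mul_le_mul_of_nonneg_left hys_norm (by norm_num : (0 : ℝ) ≤ 44712000)]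
      have hnear' : (122689728 * |t 0| + 44712000 * ‖(gnoFolEmb ys : GnoCoord L)‖) * (L : ℝ) ^ 4 ≤ μ / 4 := hΔle.trans (by rw [hμ]; exact hnear)
      have hmatch := sqrt_det_inv_slabHub_le_ref_group (L := L) hε hFs hFyy hamb hAs hambA x3 y3 z ys hcoer hr0 hr1 hD hDsmall hnear'
      -- the exponent is `≤ ½`
      have hexp : Real.exp ((3 * (Fintype.card (Fol L) : ℝ)) * ((122689728 * |t 0| + 44712000 * ‖(gnoFolEmb ys : GnoCoord L)‖) * (L : ℝ) ^ 4) /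
            ((2304 * (L : ℝ) ^ 6 * (Fintype.card (Fol L) : ℝ))⁻¹ / 2) +
          (3 * (Fintype.card (Fol L) : ℝ)) * (3219264 * (L : ℝ) ^ 4 * r) / (2304 * (L : ℝ) ^ 6 * (Fintype.card (Fol L) : ℝ))⁻¹) ≤ Real.exp (1 / 2) := by
        refine Real.exp_le_exp.2 ?_
        have h1 : (3 * (Fintype.card (Fol L) : ℝ)) * ((122689728 * |t 0| + 44712000 * ‖(gnoFolEmb ys : GnoCoord L)‖) * (L : ℝ) ^ 4) /
            ((2304 * (L : ℝ) ^ 6 * (Fintype.card (Fol L) : ℝ))⁻¹ / 2) ≤ 1 / 4 := by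
          refine le_trans ?_ hE1
          rw [← hμ]
          refine div_le_div_of_nonneg_right (mul_le_mul_of_nonneg_left hΔle (by positivity)) (by positivity)
        linarith
      have hDle : ENNReal.ofReal ((Real.sqrt (LinearMap.det (A ((((x3, y3), (z, (0 : Fol L → Fin 3 → ℝ))) : GnoCoord L) + gnoFolEmb ys))))⁻¹) ≤
          ENNReal.ofReal (Real.exp (1 / 2)) * Dref := by
        refine hmatch.trans ?_
        rw [hDref, hx0, hy0]
        exact mul_le_mul' (ENNReal.ofReal_le_ofReal hexp) le_rfl
      -- assemble: `E·(Gb/√det + tail)·XYZ ≤ (A·Dref + T1t)·XYZ ≤ …`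
      have hG : ENNReal.ofReal (Gb / Real.sqrt (LinearMap.det (A ((((x3, y3), (z, (0 : Fol L → Fin 3 → ℝ))) : GnoCoord L) + gnoFolEmb ys)))) ≤ Aconst * Dref := by
        rw [div_eq_mul_inv, ENNReal.ofReal_mul hGb0]
        calc ENNReal.ofReal Gb * ENNReal.ofReal ((Real.sqrt (LinearMap.det (A ((((x3, y3), (z, (0 : Fol L → Fin 3 → ℝ))) : GnoCoord L) + gnoFolEmb ys))))⁻¹)
            ≤ ENNReal.ofReal Gb * (ENNReal.ofReal (Real.exp (1 / 2)) * Dref) := mul_le_mul' le_rfl hDle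
          _ = Aconst * Dref := by rw [hA, ← mul_assoc, ← ENNReal.ofReal_mul hGb0, mul_comm Gb]
      have hint' : ∫⁻ F : Fol L → Fin 3 → ℝ, ENNReal.ofReal (((1 + (t 0) ^ 2)⁻¹) ^ 2 * gnoDensity (((x3, y3), (z, F)) : GnoCoord L)) * g (t 0, (((x3, y3), (z, F)) : GnoCoord L)) ≤
          ENNReal.ofReal (Real.exp (-(5 * b / 6 * m))) *
            (ENNReal.ofReal (Gb / Real.sqrt (LinearMap.det (A ((((x3, y3), (z, (0 : Fol L → Fin 3 → ℝ))) : GnoCoord L) + gnoFolEmb ys)))) + T1t) * (X * Y * Z) := by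
        rw [hGb, hT1t, hμ, hm]
        exact hint.trans (le_of_eq (by ring))
      have h1 := ennreal_glue_le hint' hEle1 hG
      calc _ ≤ (Aconst * Dref + T1t) * (X * Y * Z) := h1
        _ ≤ (Aconst * Dref + (Tfar + T1t + T2)) * (X * Y * Z) := by
            refine mul_le_mul' (add_le_add le_rfl ?_) le_rfl
            calc T1t ≤ Tfar + T1t := le_add_self
              _ ≤ Tfar + T1t + T2 := le_self_add
        _ = (Aconst * Dref + (Tfar + T1t + T2)) * X * Y * Z := by ring
    · -- NEAR₂: crude determinant, paid by the floor
      have hfar3 : r < Real.sqrt (2 * ((u.1 ^ 2 + u.2 ^ 2) / (1 + (t 1) ^ 2 + (u.1 ^ 2 + u.2 ^ 2)))) +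
          Real.sqrt (2 * (((z 0) ^ 2 + (z 1) ^ 2 + (z 2) ^ 2) / (1 + ((z 0) ^ 2 + (z 1) ^ 2 + (z 2) ^ 2)))) +
          Real.sqrt (2 * ((v 0 ^ 2 + v 1 ^ 2) / (1 + (t 2) ^ 2 + (v 0 ^ 2 + v 1 ^ 2)))) := by
        have h := not_le.1 hD
        rw [hx0, hx1, hx2, hy0, hy1, hy2] at h
        have e1 : 2 * (u.1 ^ 2 + u.2 ^ 2) / (1 + ((t 1) ^ 2 + u.1 ^ 2 + u.2 ^ 2)) = 2 * ((u.1 ^ 2 + u.2 ^ 2) / (1 + (t 1) ^ 2 + (u.1 ^ 2 + u.2 ^ 2))) := by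
          rw [mul_div_assoc]; congr 1; ring
        have e2 : 2 * ((z 0) ^ 2 + (z 1) ^ 2 + (z 2) ^ 2) / (1 + ((z 0) ^ 2 + (z 1) ^ 2 + (z 2) ^ 2)) =
            2 * (((z 0) ^ 2 + (z 1) ^ 2 + (z 2) ^ 2) / (1 + ((z 0) ^ 2 + (z 1) ^ 2 + (z 2) ^ 2))) := by rw [mul_div_assoc]
        have e3 : 2 * (v 0 ^ 2 + v 1 ^ 2) / (1 + ((t 2) ^ 2 + v 0 ^ 2 + v 1 ^ 2)) = 2 * ((v 0 ^ 2 + v 1 ^ 2) / (1 + (t 2) ^ 2 + (v 0 ^ 2 + v 1 ^ 2))) := by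
          rw [mul_div_assoc]; congr 1; ring
        rw [e1, e2, e3] at h
        exact h
      have hB0nn : 0 ≤ 16 * (t 0) ^ 2 / (1 + (t 0) ^ 2) + 8 * (t 1) ^ 2 / ((1 + (t 1) ^ 2) * (1 + (t 0) ^ 2)) + 4 * (t 2) ^ 2 / (1 + (t 2) ^ 2) := by positivity
      have hfloor := three_floor_ge_of_groupFar (B₀ := 16 * (t 0) ^ 2 / (1 + (t 0) ^ 2) + 8 * (t 1) ^ 2 / ((1 + (t 1) ^ 2) * (1 + (t 0) ^ 2)) + 4 * (t 2) ^ 2 / (1 + (t 2) ^ 2))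
        (X0 := (t 1) ^ 2) (U := u.1 ^ 2 + u.2 ^ 2) (Y0 := (t 2) ^ 2) (V := v 0 ^ 2 + v 1 ^ 2) (W := (z 0) ^ 2 + (z 1) ^ 2 + (z 2) ^ 2)
        hr0.le hB0nn (sq_nonneg _) (by positivity) (sq_nonneg _) (by positivity) (by positivity) hτr hloc hfar3
      -- `m ≥ floor/55200L⁶ ≥ κ₂`
      have hthree := endGauss_three_floor (L := L) (t 0) hδ ε (((x3, y3), (z, gnoFolBlocks ys)) : GnoCoord L) hux
      dsimp only at hthree
      rw [← leaders_add_gnoFolEmb] at hthree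
      have hmge : min (12 * τ ^ 2) 1 * (r ^ 2 / 18) / (55200 * (L : ℝ) ^ 6) ≤ m := by
        rw [div_le_iff₀ (by positivity), hm]
        refine hfloor.trans ?_
        have e : normSq3 z = (z 0) ^ 2 + (z 1) ^ 2 + (z 2) ^ 2 := by
          rw [show z = ![z 0, z 1, z 2] from by ext i; fin_cases i <;> rfl, normSq3_vec3]; simp
        rw [hx0, hx1, hx2, hy0, hy1, hy2, e] at hthree
        have e2 : (16 * t 0 ^ 2 / (1 + t 0 ^ 2) + 8 * t 1 ^ 2 / ((1 + t 1 ^ 2) * (1 + t 0 ^ 2)) + 4 * t 2 ^ 2 / (1 + t 2 ^ 2)) *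
              ((u.1 ^ 2 + u.2 ^ 2) / (1 + t 1 ^ 2 + (u.1 ^ 2 + u.2 ^ 2))) + (v 0 ^ 2 + v 1 ^ 2) / (1 + t 2 ^ 2 + (v 0 ^ 2 + v 1 ^ 2)) +
              ((z 0) ^ 2 + (z 1) ^ 2 + (z 2) ^ 2) / (1 + ((z 0) ^ 2 + (z 1) ^ 2 + (z 2) ^ 2)) =
            (16 * t 0 ^ 2 / (1 + t 0 ^ 2) + 8 * t 1 ^ 2 / ((1 + t 1 ^ 2) * (1 + t 0 ^ 2)) + 4 * t 2 ^ 2 / (1 + t 2 ^ 2)) *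
              (u.1 ^ 2 + u.2 ^ 2) / (1 + t 1 ^ 2 + (u.1 ^ 2 + u.2 ^ 2)) + (v 0 ^ 2 + v 1 ^ 2) / (1 + t 2 ^ 2 + (v 0 ^ 2 + v 1 ^ 2)) +
              ((z 0) ^ 2 + (z 1) ^ 2 + (z 2) ^ 2) / (1 + ((z 0) ^ 2 + (z 1) ^ 2 + (z 2) ^ 2)) := by ring
        linarith [hthree, e2]
      have hEle2 : ENNReal.ofReal (Real.exp (-(5 * b / 6 * m))) ≤ ENNReal.ofReal (Real.exp (-(5 * b / 6 * (min (12 * τ ^ 2) 1 * (r ^ 2 / 18) / (55200 * (L : ℝ) ^ 6))))) :=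
        ENNReal.ofReal_le_ofReal (Real.exp_le_exp.2 (neg_le_neg (mul_le_mul_of_nonneg_left hmge (by positivity))))
      -- crude determinant
      have hsqrt : (Real.sqrt (LinearMap.det (A ((((x3, y3), (z, (0 : Fol L → Fin 3 → ℝ))) : GnoCoord L) + gnoFolEmb ys))))⁻¹ ≤ ((μ / 2) ^ dF)⁻¹ ^ (1 / 2 : ℝ) := by
        have h1 : (Real.sqrt (LinearMap.det (A ((((x3, y3), (z, (0 : Fol L → Fin 3 → ℝ))) : GnoCoord L) + gnoFolEmb ys))))⁻¹ ≤ (Real.sqrt ((μ / 2) ^ dF))⁻¹ :=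
          inv_anti₀ (Real.sqrt_pos.2 (by positivity)) (Real.sqrt_le_sqrt hdet)
        rw [Real.sqrt_eq_rpow ((μ / 2) ^ dF), ← Real.inv_rpow (by positivity)] at h1
        exact h1
      have hG : ENNReal.ofReal (Gb / Real.sqrt (LinearMap.det (A ((((x3, y3), (z, (0 : Fol L → Fin 3 → ℝ))) : GnoCoord L) + gnoFolEmb ys)))) ≤
          ENNReal.ofReal (Gb * ((μ / 2) ^ dF)⁻¹ ^ (1 / 2 : ℝ)) := by
        rw [div_eq_mul_inv]; exact ENNReal.ofReal_le_ofReal (mul_le_mul_of_nonneg_left hsqrt hGb0)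
      have hint' : ∫⁻ F : Fol L → Fin 3 → ℝ, ENNReal.ofReal (((1 + (t 0) ^ 2)⁻¹) ^ 2 * gnoDensity (((x3, y3), (z, F)) : GnoCoord L)) * g (t 0, (((x3, y3), (z, F)) : GnoCoord L)) ≤
          ENNReal.ofReal (Real.exp (-(5 * b / 6 * m))) *
            (ENNReal.ofReal (Gb / Real.sqrt (LinearMap.det (A ((((x3, y3), (z, (0 : Fol L → Fin 3 → ℝ))) : GnoCoord L) + gnoFolEmb ys)))) + T1t) * (X * Y * Z) := by
        rw [hGb, hT1t, hμ, hm]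
        exact hint.trans (le_of_eq (by ring))
      have h2 : ∫⁻ F : Fol L → Fin 3 → ℝ, ENNReal.ofReal (((1 + (t 0) ^ 2)⁻¹) ^ 2 * gnoDensity (((x3, y3), (z, F)) : GnoCoord L)) * g (t 0, (((x3, y3), (z, F)) : GnoCoord L)) ≤
          ENNReal.ofReal (Real.exp (-(5 * b / 6 * (min (12 * τ ^ 2) 1 * (r ^ 2 / 18) / (55200 * (L : ℝ) ^ 6))))) *
            (ENNReal.ofReal (Gb * ((μ / 2) ^ dF)⁻¹ ^ (1 / 2 : ℝ)) + T1t) * (X * Y * Z) :=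
        hint'.trans (mul_le_mul' (mul_le_mul' hEle2 (add_le_add hG (le_refl T1t))) (le_refl (X * Y * Z)))
      calc _ ≤ ENNReal.ofReal (Real.exp (-(5 * b / 6 * (min (12 * τ ^ 2) 1 * (r ^ 2 / 18) / (55200 * (L : ℝ) ^ 6))))) *
            (ENNReal.ofReal (Gb * ((μ / 2) ^ dF)⁻¹ ^ (1 / 2 : ℝ)) + T1t) * (X * Y * Z) := h2
        _ ≤ (T2 + T1t) * (X * Y * Z) := by
            refine mul_le_mul' ?_ le_rfl
            rw [mul_add, hT2, ENNReal.ofReal_mul (Real.exp_pos _).le]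
            refine add_le_add le_rfl ?_
            calc ENNReal.ofReal (Real.exp (-(5 * b / 6 * (min (12 * τ ^ 2) 1 * (r ^ 2 / 18) / (55200 * (L : ℝ) ^ 6))))) * T1t ≤ 1 * T1t := by
                  refine mul_le_mul' ?_ le_rfl
                  rw [← ENNReal.ofReal_one]; refine ENNReal.ofReal_le_ofReal ?_
                  rw [Real.exp_le_one_iff, neg_nonpos]; positivity
              _ = T1t := one_mul _
        _ ≤ (Aconst * Dref + (Tfar + T1t + T2)) * (X * Y * Z) := by
            refine mul_le_mul' ?_ le_rfl
            calc T2 + T1t = T1t + T2 := add_comm _ _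
              _ ≤ Tfar + T1t + T2 := by rw [add_assoc]; exact le_add_self
              _ ≤ Aconst * Dref + (Tfar + T1t + T2) := le_add_self
        _ = (Aconst * Dref + (Tfar + T1t + T2)) * X * Y * Z := by ring

end Summit.QuantumFields.YangMills.Theorems.SwapVirialDeficit.SectorLaplace

end
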